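import Summits.Ventures.HodgeRepro.CyclicCosetThreshold
import Summits.Ventures.HodgeRepro.KleinCosetThreshold

/-!
# Coset quadruples, part 1 of 2: the generic construction of a CM type from a pattern on the cosets

Blind re-derivation cell `pub-hodge-repro`, seat `p1` (gen 10).  The first half of `CosetQuadExists.lean` (split at a
section boundary for the cell's ≤ 400-line landing rule; declaration text unchanged): coset representatives and
coordinates for the range of an injective hom `ψ : P →* G` (`rep`, `coord`), the CM type `typeOf` cut out by a pattern
`χ : L → P → Bool` through a labelling of the cosets, the GENERIC theorem `exists_quad_of_pattern` (a pattern with the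
three local conditions — CM, `SumTwo`, no common bad set — and `|L| · |P| ≤ |G|` gives a CM type whose twists by the
`ψ (t i)` are `SumTwo` without a conjugate pair), and the power homs `zmodPowHom n g : ℤ/n →* G` for `gⁿ = 1`.
Part 2 (`CosetQuadExists.lean`) instantiates it for the cyclic and the Klein subgroup of order `4`; the same theorem
drives `RectQuad6.lean`, `RectQuadOdd.lean`, `RectQuad33.lean`.  The construction is described in part 2's docstring.
-/

set_option autoImplicit false

open Finset
open scoped Pointwise

namespace HodgeRepro.CosetQuad

variable {G : Type*} [Group G]

/-! ### Coset representatives and coordinates for the range of an injective hom -/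

section Coord

variable {P : Type*} [Group P]

/-- The chosen representative of the left coset `x · ψ.range`. -/
noncomputable def rep (ψ : P →* G) (x : G) : G := (QuotientGroup.mk x : G ⧸ ψ.range).out

/-- Right multiplication by an element of the range does not change the representative. -/
theorem rep_mul (ψ : P →* G) (x : G) (p : P) : rep ψ (x * ψ p) = rep ψ x := by
  unfold rep
  rw [QuotientGroup.mk_mul_of_mem x (MonoidHom.mem_range.2 ⟨p, rfl⟩)]

/-- The representative of a representative is itself. -/
theorem rep_out (ψ : P →* G) (q : G ⧸ ψ.range) : rep ψ q.out = q.out := by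
  unfold rep
  rw [QuotientGroup.out_eq']

/-- `(rep x)⁻¹ · x` lies in the range. -/
theorem inv_rep_mul_mem (ψ : P →* G) (x : G) : (rep ψ x)⁻¹ * x ∈ ψ.range := by
  obtain ⟨h, hh⟩ := QuotientGroup.mk_out_eq_mul ψ.range x
  unfold rep
  rw [hh, mul_inv_rev, mul_assoc, inv_mul_cancel, mul_one]
  exact ψ.range.inv_mem h.2

/-- The coordinate of `x`: the element `p` of `P` with `x = rep x · ψ p`. -/
noncomputable def coord (ψ : P →* G) (hψ : Function.Injective ψ) (x : G) : P :=
  (MonoidHom.ofInjective hψ).symm ⟨(rep ψ x)⁻¹ * x, inv_rep_mul_mem ψ x⟩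

/-- `ψ (coord x) = (rep x)⁻¹ · x`. -/
theorem map_coord (ψ : P →* G) (hψ : Function.Injective ψ) (x : G) :
    ψ (coord ψ hψ x) = (rep ψ x)⁻¹ * x :=
  MonoidHom.apply_ofInjective_symm hψ _

/-- The coordinate is multiplicative in the range direction: `coord (x · ψ p) = coord x · p`. -/
theorem coord_mul (ψ : P →* G) (hψ : Function.Injective ψ) (x : G) (p : P) :
    coord ψ hψ (x * ψ p) = coord ψ hψ x * p := by
  apply hψ
  rw [map_mul, map_coord, map_coord, rep_mul, mul_assoc]

/-- The coordinate of a representative is `1`. -/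
theorem coord_out (ψ : P →* G) (hψ : Function.Injective ψ) (q : G ⧸ ψ.range) :
    coord ψ hψ q.out = 1 := by
  apply hψ
  rw [map_coord, rep_out, inv_mul_cancel, map_one]

/-- The coordinate of `q.out · ψ p` is `p`. -/
theorem coord_out_mul (ψ : P →* G) (hψ : Function.Injective ψ) (q : G ⧸ ψ.range) (p : P) :
    coord ψ hψ (q.out * ψ p) = p := by
  rw [coord_mul, coord_out, one_mul]

end Coord

/-! ### The generic construction: a CM type from a pattern on the cosets -/

section Pattern

variable [Fintype G]
variable {P : Type*} [Group P]
variable {L : Type*}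

/-- The CM type cut out by the pattern `χ` through the labelling `lab` of the cosets of `ψ.range`:
`x ∈ Φ ↔ χ (lab (x · ψ.range)) (coord x)`. -/
noncomputable def typeOf (ψ : P →* G) (hψ : Function.Injective ψ) (lab : G ⧸ ψ.range → L)
    (χ : L → P → Bool) : Finset G :=
  univ.filter fun x => χ (lab (QuotientGroup.mk x)) (coord ψ hψ x) = true

/-- Membership in `typeOf`. -/
theorem mem_typeOf (ψ : P →* G) (hψ : Function.Injective ψ) (lab : G ⧸ ψ.range → L)
    (χ : L → P → Bool) (x : G) :
    x ∈ typeOf ψ hψ lab χ ↔ χ (lab (QuotientGroup.mk x)) (coord ψ hψ x) = true := by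
  simp [typeOf]

/-- **The generic construction.**  `ψ : P →* G` injective with `ψ e₀ = c`, twists `ψ (t i)`, and a
pattern `χ : L → P → Bool` with (1) `χ l (p e₀) = ¬ χ l p` (the CM condition), (2) exactly two of the
four `χ l (p (t i)⁻¹)` hold (`SumTwo`), (3) for no `i, j` is `χ l (p (t j)⁻¹) ↔ χ l (p e₀ (t i)⁻¹)` true
for ALL labels `l` and coordinates `p` (no conjugate pair).  If `|L| · |P| ≤ |G|` — so that every label
is carried by some coset — there is a CM type whose twists by the `ψ (t i)` are `SumTwo` without a
conjugate pair. -/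
theorem exists_quad_of_pattern [DecidableEq G] [Fintype P] [Fintype L] [Nonempty L]
    (ψ : P →* G) (hψ : Function.Injective ψ) {c : G}
    (hc : IsComplexConj c) {e₀ : P} (he : ψ e₀ = c) (t : Fin 4 → P) (χ : L → P → Bool)
    (h1 : ∀ l p, χ l (p * e₀) = !χ l p)
    (h2 : ∀ l p, (univ.filter fun i : Fin 4 => χ l (p * (t i)⁻¹) = true).card = 2)
    (h3 : ∀ i j : Fin 4,
      ¬ ∀ l p, (χ l (p * (t j)⁻¹) = true ↔ χ l (p * (e₀ * (t i)⁻¹)) = true))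
    (hcard : Fintype.card L * Fintype.card P ≤ Fintype.card G) :
    ∃ Φ : Finset G, IsCMType c Φ ∧ SumTwo (fun i => rmul Φ (ψ (t i))) ∧
      ∀ i j : Fin 4, rmul Φ (ψ (t j)) ≠ c • rmul Φ (ψ (t i)) := by
  classical
  -- the cosets of `ψ.range` number at least `|L|`
  have hL : Fintype.card L ≤ Fintype.card (G ⧸ ψ.range) := by
    have h := Subgroup.card_eq_card_quotient_mul_card_subgroup ψ.range
    have hP : Nat.card ψ.range = Nat.card P :=
      (Nat.card_congr (MonoidHom.ofInjective hψ).toEquiv).symm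
    rw [hP, Nat.card_eq_fintype_card, Nat.card_eq_fintype_card, Nat.card_eq_fintype_card] at h
    rw [h] at hcard
    exact Nat.le_of_mul_le_mul_right hcard (Fintype.card_pos_iff.2 ⟨1⟩)
  obtain ⟨emb⟩ := Function.Embedding.nonempty_of_card_le hL
  have hlab : Function.Surjective (Function.invFun emb) := Function.invFun_surjective emb.injective
  refine ⟨typeOf ψ hψ (Function.invFun emb) χ, ?_, ?_, ?_⟩
  · -- the CM condition
    intro x
    rw [mem_typeOf, mem_typeOf, hc.comm, ← he,
      QuotientGroup.mk_mul_of_mem x (MonoidHom.mem_range.2 ⟨e₀, rfl⟩), coord_mul, h1]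
    cases hb : χ (Function.invFun emb (QuotientGroup.mk x)) (coord ψ hψ x) <;> simp
  · -- `SumTwo`
    intro x
    show (univ.filter fun i : Fin 4 =>
      x ∈ rmul (typeOf ψ hψ (Function.invFun emb) χ) (ψ (t i))).card = 2
    refine Eq.trans ?_ (h2 (Function.invFun emb (QuotientGroup.mk x)) (coord ψ hψ x))
    congr 1
    apply Finset.filter_congr
    intro i _
    rw [mem_rmul, ← map_inv, mem_typeOf,
      QuotientGroup.mk_mul_of_mem x (MonoidHom.mem_range.2 ⟨(t i)⁻¹, rfl⟩), coord_mul]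
  · -- no conjugate pair
    intro i j hij
    apply h3 i j
    intro l p
    obtain ⟨q, hq⟩ := hlab l
    have hx := Finset.ext_iff.1 hij (q.out * ψ p)
    rw [hc.mem_smul_iff, mem_rmul, mem_rmul, hc.comm, ← he, ← map_inv, ← map_inv, mem_typeOf,
      mem_typeOf, mul_assoc, ← map_mul, mul_assoc, mul_assoc, ← map_mul, ← map_mul,
      QuotientGroup.mk_mul_of_mem q.out (MonoidHom.mem_range.2 ⟨p * (t j)⁻¹, rfl⟩),
      QuotientGroup.mk_mul_of_mem q.out (MonoidHom.mem_range.2 ⟨p * (e₀ * (t i)⁻¹), rfl⟩),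
      QuotientGroup.out_eq', hq, coord_out_mul, coord_out_mul] at hx
    exact hx

end Pattern

/-! ### The abstract groups `ℤ/n` as `Multiplicative (ZMod n)` and the power homs -/

section PowHom

/-- `gⁿ = 1` makes `g ^ ·` `n`-periodic: `g ^ (m % n) = g ^ m`. -/
theorem pow_mod_of_pow_eq_one {g : G} {n : ℕ} (hg : g ^ n = 1) (m : ℕ) : g ^ (m % n) = g ^ m := by
  conv_rhs => rw [← Nat.mod_add_div m n, pow_add, pow_mul, hg, one_pow, mul_one]

/-- The hom `ℤ/n →* G`, `i ↦ gⁱ`, for `g` with `gⁿ = 1` (`n ≠ 0`). -/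
def zmodPowHom (n : ℕ) [NeZero n] (g : G) (hg : g ^ n = 1) : Multiplicative (ZMod n) →* G where
  toFun p := g ^ (Multiplicative.toAdd p).val
  map_one' := by simp
  map_mul' p q := by
    show g ^ (Multiplicative.toAdd p + Multiplicative.toAdd q).val =
      g ^ (Multiplicative.toAdd p).val * g ^ (Multiplicative.toAdd q).val
    rw [ZMod.val_add, ← pow_add]
    exact pow_mod_of_pow_eq_one hg _

/-- `zmodPowHom n g hg p = g ^ (toAdd p).val`. -/
@[simp] theorem zmodPowHom_apply (n : ℕ) [NeZero n] (g : G) (hg : g ^ n = 1)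
    (p : Multiplicative (ZMod n)) : zmodPowHom n g hg p = g ^ (Multiplicative.toAdd p).val := rfl

/-- `(1 : ℤ/2).val = 1`. -/
theorem val_one_two : (1 : ZMod 2).val = 1 := rfl

/-- A complex conjugation squares to `1`. -/
theorem conj_sq_eq_one {c : G} (hc : IsComplexConj c) : c ^ 2 = 1 := by
  rw [pow_two, hc.mul_self]

end PowHom

end HodgeRepro.CosetQuad
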